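import Mathlib
import Literature.Analysis.FluidPDE.TaoCascadeNoLow
import Literature.Analysis.FluidPDE.TaoCascadeLowModes
import Literature.Analysis.FluidPDE.Tao2016AveragedNS.RestartedCascadeFlows
import HarnessLib

/-!
# `GappedFrontRobust`, tools for the (step) clause: BLOCK AND TAIL ENERGY CAPS of a pseudo-flow
  (helper for item stmt-NavierStokesRegularity-20423, crux K_B of routes TaoLadderRungThree /
  TaoLadderRungTwo / TaoLadderRungTwoPoly, and for its announced restatement over `GapData₂`)

HONEST FRAMING: elementary real-analysis lemmas about Tao-type MODEL lattice pseudo-flows (Tao 2016, §4: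
the local energy inequality (4.9) has no defect term and the cubic sums telescope under the
cancellation condition (4.3)), in the cell vocabulary `TaoCascade.PseudoFlowOn` of the tree module
`RestartedCascadeFlows` and the cubic sums `TaoCascade.botSum` / `topSum` of `TaoCascadeNoLow`. Nothing
here is a statement about the Navier–Stokes equations, and nothing is asserted about any table.

WHAT THIS IS FOR. The (step) clause `RobustStep` of K_B compares an `(η, η)`-pseudo-flow with the exact
flow of a gap certificate over one clock window. Far AHEAD of the front (the `TailFat` zone) no Grönwall
comparison is needed: energy enters the block of shells `k ≥ K` only through the bond `K-1 | K`, at the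
rate `botSum(K-1) = ∑ α_{·,(0,0,1)} (1+ε₀)^{5(K-1)/2} S_{K-1} S_{K-1} S_K` — quadratic in the shell below,
linear in the block's bottom shell. This file proves that ONE-DIRECTIONAL bookkeeping for an arbitrary
pseudo-flow with a cancelling table: `abs_botSum_le_of_abs_le`, `abs_botSum_le_energy` (size of the
bond flux); `pseudoFlowOn_block_energy_le` (for every finite block `K, …, K+L-1` and `s ∈ [0, τ]`,
`∑_{block} ∑_i F_{i,k}(s) ≤ ∑_{block} ∑_i F₀_{i,k} + ∫₀^s (botSum(K-1) − botSum(K+L-1))` — the per-shell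
energy cap `F ≤ F₀ + ∫ quadTerm·S` of `…GappedFrontRobustEnergyCap`, re-derived inline so that this
module depends on no route file, summed and telescoped by the tree's `sum_range_sum_quadTerm_mul`);
`abs_le_of_weight`, `abs_botSum_le_of_weight`, `pseudoFlowOn_botSum_tail_small` (by the a priori
regularity (4.5) the top flux `botSum(N)` is uniformly small on `[0, τ]` as `N → +∞`);
`pseudoFlowOn_tail_energy_le` (TAIL ENERGY CAP: if all partial sums of the start energies over
`k ≥ K` are `≤ E₀`, every partial sum of the energies at time `s` is `≤ E₀ + ∫₀^s botSum(K-1)`) and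
its per-shell form `pseudoFlowOn_shell_energy_le_tail`. The amplitude form and the square-root
(Bihari) step of the tail induction are in `…GappedFrontRobustTailStep`.
No infinite sums are used: "tail energy ≤ E₀" is spelled as a bound on all finite partial sums.
-/

noncomputable section

-- the sub-problem namespace `Summit.NavierStokesRegularity.NavierStokesRegularity` repeats the summit name by design (D-0017)
set_option linter.dupNamespace false

namespace Summit.NavierStokesRegularity.NavierStokesRegularity.Theorems

open Set MeasureTheory intervalIntegral Literature.Analysis.FluidPDE Literature.Analysis.FluidPDE.TaoCascade

namespace GappedFrontRobust

variable {m : ℕ}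

/-! ### The bond flux `botSum(n)` -/

/-- **Size of the bond flux from amplitude bounds**: if `|X_{i,n}(t)| ≤ P` and `|X_{i,n+1}(t)| ≤ Q`
for all modes, then `|botSum(n)(t)| ≤ (1+ε₀)^{5n/2} P² Q ∑_{i₁,i₂,i₃} |α_{i,(0,0,1)}|`.
[cite: Tao2016AveragedNS, §4 proof of (4.13) (the boundary terms)] -/
theorem abs_botSum_le_of_abs_le (ε₀ : ℝ) (hε : 0 < 1 + ε₀)
    (α : Fin m → Fin m → Fin m → ℤ × ℤ × ℤ → ℝ) (X : Fin m → ℤ → ℝ → ℝ) (n : ℤ) (t : ℝ)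
    {P Q : ℝ} (hP : ∀ i, |X i n t| ≤ P) (hQ : ∀ i, |X i (n + 1) t| ≤ Q) :
    |botSum ε₀ α X n t| ≤
      (1 + ε₀) ^ ((5 : ℝ) * n / 2) * P ^ 2 * Q * ∑ i₁, ∑ i₂, ∑ i₃, |α i₁ i₂ i₃ (0, 0, 1)| := by
  set s : ℝ := (1 + ε₀) ^ ((5 : ℝ) * n / 2) with hs
  have hc : 0 ≤ s := (Real.rpow_pos_of_pos hε _).le
  have hterm : ∀ i₁ i₂ i₃ : Fin m,
      |α i₁ i₂ i₃ (0, 0, 1) * s * (X i₁ n t * X i₂ n t * X i₃ (n + 1) t)| ≤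
        s * P ^ 2 * Q * |α i₁ i₂ i₃ (0, 0, 1)| := by
    intro i₁ i₂ i₃
    have hP0 : 0 ≤ P := (abs_nonneg _).trans (hP i₁)
    have h3 : |X i₁ n t * X i₂ n t * X i₃ (n + 1) t| ≤ P ^ 2 * Q := by
      rw [abs_mul, abs_mul, sq]
      exact mul_le_mul (mul_le_mul (hP i₁) (hP i₂) (abs_nonneg _) hP0) (hQ i₃) (abs_nonneg _)
        (mul_nonneg hP0 hP0)
    calc |α i₁ i₂ i₃ (0, 0, 1) * s * (X i₁ n t * X i₂ n t * X i₃ (n + 1) t)|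
        = |α i₁ i₂ i₃ (0, 0, 1)| * s * |X i₁ n t * X i₂ n t * X i₃ (n + 1) t| := by
          rw [abs_mul, abs_mul, abs_of_nonneg hc]
      _ ≤ |α i₁ i₂ i₃ (0, 0, 1)| * s * (P ^ 2 * Q) := by gcongr
      _ = s * P ^ 2 * Q * |α i₁ i₂ i₃ (0, 0, 1)| := by ring
  unfold botSum
  rw [← hs]
  simp only [Finset.mul_sum]
  refine (Finset.abs_sum_le_sum_abs _ _).trans (Finset.sum_le_sum fun i₁ _ => ?_)
  refine (Finset.abs_sum_le_sum_abs _ _).trans (Finset.sum_le_sum fun i₂ _ => ?_)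
  refine (Finset.abs_sum_le_sum_abs _ _).trans (Finset.sum_le_sum fun i₃ _ => ?_)
  exact hterm i₁ i₂ i₃

/-- **Size of the bond flux from the energies of the lower shell**: if `E_{i,n}(t) ≥ 0`,
`½X_{i,n}(t)² ≤ E_{i,n}(t)` and `|X_{i,n+1}(t)| ≤ Q` for all modes, then
`|botSum(n)(t)| ≤ 2 (1+ε₀)^{5n/2} Q (∑_{i₁,i₂,i₃} |α_{i,(0,0,1)}|) ∑_i E_{i,n}(t)` — every term of
`botSum(n)` carries two factors at shell `n`. This is the ONE-DIRECTIONAL structure of the energy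
transfer on Tao's shift set: the flux into the shells above `n` is controlled by the energy AT `n` times an
amplitude bound at `n+1`. [cite: Tao2016AveragedNS, §4 proof of (4.13) (two factors bounded by the energies)] -/
theorem abs_botSum_le_energy (ε₀ : ℝ) (hε : 0 < 1 + ε₀)
    (α : Fin m → Fin m → Fin m → ℤ × ℤ × ℤ → ℝ) (X E : Fin m → ℤ → ℝ → ℝ) (n : ℤ) (t : ℝ)
    {Q : ℝ} (hQ : ∀ i, |X i (n + 1) t| ≤ Q)
    (hE : ∀ i, 0 ≤ E i n t) (hXE : ∀ i, (1 / 2) * X i n t ^ 2 ≤ E i n t) :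
    |botSum ε₀ α X n t| ≤
      2 * (1 + ε₀) ^ ((5 : ℝ) * n / 2) * Q * (∑ i₁, ∑ i₂, ∑ i₃, |α i₁ i₂ i₃ (0, 0, 1)|) *
        ∑ i, E i n t := by
  set s : ℝ := (1 + ε₀) ^ ((5 : ℝ) * n / 2) with hs
  set Etot : ℝ := ∑ i, E i n t with hEtot
  have hc : 0 ≤ s := (Real.rpow_pos_of_pos hε _).le
  have hEi : ∀ i, E i n t ≤ Etot := fun i =>
    Finset.single_le_sum (f := fun i => E i n t) (fun j _ => hE j) (Finset.mem_univ i)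
  have hEtot0 : 0 ≤ Etot := Finset.sum_nonneg fun j _ => hE j
  have hterm : ∀ i₁ i₂ i₃ : Fin m,
      |α i₁ i₂ i₃ (0, 0, 1) * s * (X i₁ n t * X i₂ n t * X i₃ (n + 1) t)| ≤
        2 * s * Q * Etot * |α i₁ i₂ i₃ (0, 0, 1)| := by
    intro i₁ i₂ i₃
    have h2 : |X i₁ n t * X i₂ n t| ≤ 2 * Etot := by
      have := abs_mul_le_energy_add (hXE i₁) (hXE i₂)
      linarith [hEi i₁, hEi i₂]
    have h3 : |X i₁ n t * X i₂ n t * X i₃ (n + 1) t| ≤ 2 * Etot * Q := by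
      rw [abs_mul]
      exact mul_le_mul h2 (hQ i₃) (abs_nonneg _) (by linarith)
    calc |α i₁ i₂ i₃ (0, 0, 1) * s * (X i₁ n t * X i₂ n t * X i₃ (n + 1) t)|
        = |α i₁ i₂ i₃ (0, 0, 1)| * s * |X i₁ n t * X i₂ n t * X i₃ (n + 1) t| := by
          rw [abs_mul, abs_mul, abs_of_nonneg hc]
      _ ≤ |α i₁ i₂ i₃ (0, 0, 1)| * s * (2 * Etot * Q) := by gcongr
      _ = 2 * s * Q * Etot * |α i₁ i₂ i₃ (0, 0, 1)| := by ring
  have hrew : 2 * s * Q * (∑ i₁, ∑ i₂, ∑ i₃, |α i₁ i₂ i₃ ((0 : ℤ), (0 : ℤ), (1 : ℤ))|) * Etot =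
      ∑ i₁, ∑ i₂, ∑ i₃, 2 * s * Q * Etot * |α i₁ i₂ i₃ (0, 0, 1)| := by
    simp only [Finset.mul_sum, Finset.sum_mul]
    refine Finset.sum_congr rfl fun i₁ _ => Finset.sum_congr rfl fun i₂ _ =>
      Finset.sum_congr rfl fun i₃ _ => ?_
    ring
  unfold botSum
  rw [← hs, hrew]
  refine (Finset.abs_sum_le_sum_abs _ _).trans (Finset.sum_le_sum fun i₁ _ => ?_)
  refine (Finset.abs_sum_le_sum_abs _ _).trans (Finset.sum_le_sum fun i₂ _ => ?_)
  refine (Finset.abs_sum_le_sum_abs _ _).trans (Finset.sum_le_sum fun i₃ _ => ?_)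
  exact hterm i₁ i₂ i₃

/-- The bond flux `botSum(n)` of a family of continuous amplitudes is continuous (finite sum of
products). [cite: Tao2016AveragedNS, §4 (4.3) (the cubic sums)] -/
theorem continuousOn_botSum (ε₀ : ℝ) (α : Fin m → Fin m → Fin m → ℤ × ℤ × ℤ → ℝ)
    {S : Fin m → ℤ → ℝ → ℝ} {I : Set ℝ} (hS : ∀ i n, ContinuousOn (S i n) I) (n : ℤ) :
    ContinuousOn (fun t => botSum ε₀ α S n t) I := by
  unfold botSum
  refine continuousOn_finsetSum _ fun i₁ _ => continuousOn_finsetSum _ fun i₂ _ =>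
    continuousOn_finsetSum _ fun i₃ _ => ?_
  exact continuousOn_const.mul (((hS _ _).mul (hS _ _)).mul (hS _ _))

/-- Under the cancellation condition (4.3) the summed energy nonlinearity of a block of shells is the
bond flux in at the bottom minus the bond flux out at the top:
`∑_{k<L} ∑_i quadTerm_{i,K+k} X_{i,K+k} = botSum(K-1) − botSum(K+L-1)`.
[cite: Tao2016AveragedNS, §4 proof of (4.13) (telescoping under (4.3))] -/
theorem sum_range_sum_quadTerm_mul_eq_botSum (ε₀ : ℝ) {α : Fin m → Fin m → Fin m → ℤ × ℤ × ℤ → ℝ}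
    (hα : IsCancellingCoeff α) (X : Fin m → ℤ → ℝ → ℝ) (K : ℤ) (L : ℕ) (t : ℝ) :
    ∑ k ∈ Finset.range L, ∑ i, quadTerm ε₀ α X i (K + k) t * X i (K + k) t =
      botSum ε₀ α X (K - 1) t - botSum ε₀ α X (K + L - 1) t := by
  rw [sum_range_sum_quadTerm_mul ε₀ hα X K L t, botSum_eq_neg_topSum ε₀ hα,
    botSum_eq_neg_topSum ε₀ hα]
  ring

variable {τ ε₀ : ℝ} {α : Fin m → Fin m → Fin m → ℤ × ℤ × ℤ → ℝ} {κ₁ κ₂ : ℝ}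
  {S₀ F₀ B₀ : Fin m → ℤ → ℝ} {S F : Fin m → ℤ → ℝ → ℝ}

/-! ### The block energy inequality -/

/-- **BLOCK ENERGY INEQUALITY.** Along every pseudo-flow with a cancelling table, for every finite block
of shells `K, K+1, …, K+L-1` and every `s ∈ [0, τ]`,
`∑_{k<L} ∑_i F_{i,K+k}(s) ≤ ∑_{k<L} ∑_i F₀_{i,K+k} + ∫₀^s (botSum(K-1)(u) − botSum(K+L-1)(u)) du`:
the energy of the block grows at most by the flux in through the bond below it minus the flux out
through the bond above it ((4.9) has no defect term; (4.3) telescopes the interior bonds).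
[cite: Tao2016AveragedNS, §4 Lemma 4.1 (4.9) with (4.3)] -/
theorem pseudoFlowOn_block_energy_le (h : PseudoFlowOn τ ε₀ α κ₁ κ₂ S₀ F₀ B₀ S F) (hτ : 0 < τ)
    (hα : IsCancellingCoeff α) (K : ℤ) (L : ℕ) {s : ℝ} (hs : s ∈ Icc 0 τ) :
    ∑ k ∈ Finset.range L, ∑ i, F i (K + k) s ≤
      ∑ k ∈ Finset.range L, ∑ i, F₀ i (K + k) +
        ∫ u in (0 : ℝ)..s, (botSum ε₀ α S (K - 1) u - botSum ε₀ α S (K + L - 1) u) := by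
  have hS : ∀ i n, ContinuousOn (S i n) (Icc 0 τ) := fun i n => (h.contDiffOn_S i n).continuousOn
  have hsubI : Icc 0 s ⊆ Icc 0 τ := Icc_subset_Icc_right hs.2
  have hsub : uIcc 0 s ⊆ Icc 0 τ := by rwa [uIcc_of_le hs.1]
  -- continuity of the quadratic terms (finite sums of products)
  have hq : ∀ (i : Fin m) (k : ℤ), ContinuousOn (fun t => quadTerm ε₀ α S i k t) (Icc 0 τ) := by
    intro i k
    unfold quadTerm
    refine continuousOn_finsetSum _ fun i₁ _ => continuousOn_finsetSum _ fun i₂ _ =>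
      continuousOn_finsetSum _ fun μ _ => ?_
    exact continuousOn_const.mul ((hS _ _).mul (hS _ _))
  have hint : ∀ (i : Fin m) (k : ℤ),
      IntervalIntegrable (fun u => quadTerm ε₀ α S i k u * S i k u) volume 0 s := fun i k =>
    (((hq i k).mul (hS i k)).mono hsub).intervalIntegrable
  have hint2 : ∀ k : ℤ,
      IntervalIntegrable (fun u => ∑ i, quadTerm ε₀ α S i k u * S i k u) volume 0 s := fun k =>
    ((continuousOn_finsetSum _ fun i _ => (hq i k).mul (hS i k)).mono hsub).intervalIntegrable
  -- per-shell energy cap: (4.9) integrated from `F(0) = F₀` (cf. `pseudoFlowOn_energy_cap`)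
  have hcap : ∀ (i : Fin m) (k : ℤ),
      F i k s ≤ F₀ i k + ∫ u in (0 : ℝ)..s, quadTerm ε₀ α S i k u * S i k u := by
    intro i k
    have hf := h.contDiffOn_F i k
    have hcont : ContinuousOn (F i k) (Icc 0 s) := hf.continuousOn.mono hsubI
    have hf'cont : ContinuousOn (derivWithin (F i k) (Icc 0 τ)) (Icc 0 τ) :=
      hf.continuousOn_derivWithin (uniqueDiffOn_Icc hτ) le_rfl
    have hderiv : ∀ x ∈ Ioo 0 s, HasDerivAt (F i k) (derivWithin (F i k) (Icc 0 τ) x) x := by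
      intro x hx
      have hxτ : x < τ := hx.2.trans_le hs.2
      have hxI : Icc 0 τ ∈ nhds x := Icc_mem_nhds hx.1 hxτ
      have hd : DifferentiableWithinAt ℝ (F i k) (Icc 0 τ) x :=
        (hf.differentiableOn one_ne_zero) x ⟨hx.1.le, hxτ.le⟩
      rw [derivWithin_of_mem_nhds hxI]
      exact (hd.differentiableAt hxI).hasDerivAt
    have hint' : IntervalIntegrable (derivWithin (F i k) (Icc 0 τ)) volume 0 s :=
      (hf'cont.mono hsub).intervalIntegrable
    have hftc := intervalIntegral.integral_eq_sub_of_hasDerivAt_of_le hs.1 hcont hderiv hint'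
    have hmono := intervalIntegral.integral_mono_on hs.1 hint' (hint i k)
      fun u hu => h.energy i k u (hsubI hu)
    rw [hftc, h.init_F i k] at hmono
    linarith
  calc ∑ k ∈ Finset.range L, ∑ i, F i (K + k) s
      ≤ ∑ k ∈ Finset.range L, ∑ i,
          (F₀ i (K + k) + ∫ u in (0 : ℝ)..s, quadTerm ε₀ α S i (K + k) u * S i (K + k) u) :=
        Finset.sum_le_sum fun k _ => Finset.sum_le_sum fun i _ => hcap i (K + k)
    _ = ∑ k ∈ Finset.range L, ∑ i, F₀ i (K + k) +
          ∑ k ∈ Finset.range L, ∑ i,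
            ∫ u in (0 : ℝ)..s, quadTerm ε₀ α S i (K + k) u * S i (K + k) u := by
        simp only [Finset.sum_add_distrib]
    _ = ∑ k ∈ Finset.range L, ∑ i, F₀ i (K + k) +
          ∫ u in (0 : ℝ)..s, ∑ k ∈ Finset.range L, ∑ i,
            quadTerm ε₀ α S i (K + k) u * S i (K + k) u := by
        congr 1
        rw [intervalIntegral.integral_finsetSum (s := Finset.range L) fun (k : ℕ) _ => hint2 (K + k)]
        exact Finset.sum_congr rfl fun k _ =>
          (intervalIntegral.integral_finsetSum fun i _ => hint i (K + k)).symm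
    _ = ∑ k ∈ Finset.range L, ∑ i, F₀ i (K + k) +
          ∫ u in (0 : ℝ)..s, (botSum ε₀ α S (K - 1) u - botSum ε₀ α S (K + L - 1) u) := by
        congr 1
        refine intervalIntegral.integral_congr fun u _ => ?_
        exact sum_range_sum_quadTerm_mul_eq_botSum ε₀ hα S K L u

/-! ### The a priori weight and the vanishing of the top bond flux -/

/-- From the (4.5) weight: `(1 + (1+ε₀)^{10k}) |x| ≤ M` gives `|x| ≤ M (1+ε₀)^{-10k}` (and `|x| ≤ M`).
[cite: Tao2016AveragedNS, §4 Lemma 4.1 (4.5)] -/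
theorem abs_le_of_weight {ε₀ M x : ℝ} (hε : 0 < 1 + ε₀) {k : ℤ}
    (h : (1 + (1 + ε₀) ^ ((10 : ℝ) * k)) * |x| ≤ M) :
    |x| ≤ M * (1 + ε₀) ^ (-(10 : ℝ) * k) ∧ |x| ≤ M := by
  have hq : 0 < (1 + ε₀) ^ ((10 : ℝ) * k) := Real.rpow_pos_of_pos hε _
  have hx : 0 ≤ |x| := abs_nonneg x
  have h1 : (1 + ε₀) ^ ((10 : ℝ) * k) * |x| ≤ M := by nlinarith
  have h2 : |x| ≤ M := by nlinarith
  refine ⟨?_, h2⟩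
  have hneg : (1 + ε₀) ^ (-(10 : ℝ) * k) = ((1 + ε₀) ^ ((10 : ℝ) * k))⁻¹ := by
    rw [show -(10 : ℝ) * k = -((10 : ℝ) * k) by ring, Real.rpow_neg hε.le]
  rw [hneg, ← div_eq_mul_inv, le_div_iff₀ hq]
  linarith [mul_comm ((1 + ε₀) ^ ((10 : ℝ) * k)) |x|]

/-- **The top bond flux under the (4.5) weight**: if `(1 + (1+ε₀)^{10k}) |X_{i,k}(t)| ≤ M` for all modes
and shells (`M ≥ 0`, `ε₀ ≥ 0`), then for every `N ≥ 0`,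
`|botSum(N)(t)| ≤ (1+ε₀)^{-N} M³ ∑_{i₁,i₂,i₃} |α_{i,(0,0,1)}|`.
[cite: Tao2016AveragedNS, §4 Lemma 4.1 (4.5) and proof of (4.13)] -/
theorem abs_botSum_le_of_weight (hε : 0 ≤ ε₀) (α : Fin m → Fin m → Fin m → ℤ × ℤ × ℤ → ℝ)
    (X : Fin m → ℤ → ℝ → ℝ) (t : ℝ) {M : ℝ} (hM : 0 ≤ M)
    (hX : ∀ (i : Fin m) (k : ℤ), (1 + (1 + ε₀) ^ ((10 : ℝ) * k)) * |X i k t| ≤ M)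
    {N : ℤ} (hN : 0 ≤ N) :
    |botSum ε₀ α X N t| ≤
      (1 + ε₀) ^ (-(N : ℝ)) * M ^ 3 * ∑ i₁, ∑ i₂, ∑ i₃, |α i₁ i₂ i₃ (0, 0, 1)| := by
  have hq : 0 < 1 + ε₀ := by linarith
  have hq1 : 1 ≤ 1 + ε₀ := by linarith
  set P : ℝ := M * (1 + ε₀) ^ (-(10 : ℝ) * N) with hP
  have hPN : ∀ i, |X i N t| ≤ P := fun i => (abs_le_of_weight hq (hX i N)).1
  have hPN1 : ∀ i, |X i (N + 1) t| ≤ P := by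
    intro i
    have h1 := (abs_le_of_weight hq (hX i (N + 1))).1
    refine h1.trans (mul_le_mul_of_nonneg_left ?_ hM)
    push_cast
    exact Real.rpow_le_rpow_of_exponent_le hq1 (by nlinarith [show (0:ℝ) ≤ N by exact_mod_cast hN])
  have hb := abs_botSum_le_of_abs_le ε₀ hq α X N t hPN hPN1
  have hC : 0 ≤ ∑ i₁ : Fin m, ∑ i₂ : Fin m, ∑ i₃ : Fin m, |α i₁ i₂ i₃ (0, 0, 1)| :=
    Finset.sum_nonneg fun _ _ => Finset.sum_nonneg fun _ _ => Finset.sum_nonneg fun _ _ =>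
      abs_nonneg _
  -- the powers: (1+ε₀)^{5N/2} P² P = M³ (1+ε₀)^{5N/2 - 30N} ≤ M³ (1+ε₀)^{-N}
  have hpow : (1 + ε₀) ^ ((5 : ℝ) * N / 2) * P ^ 2 * P ≤ (1 + ε₀) ^ (-(N : ℝ)) * M ^ 3 := by
    have hq3 : (1 + ε₀) ^ (3 * (-(10 : ℝ) * N)) = ((1 + ε₀) ^ (-(10 : ℝ) * N)) ^ 3 := by
      rw [show (3 : ℝ) * (-(10 : ℝ) * N) = (-(10 : ℝ) * N) * ((3 : ℕ) : ℝ) by push_cast; ring]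
      exact Real.rpow_mul_natCast hq.le _ 3
    have h3 : (1 + ε₀) ^ ((5 : ℝ) * N / 2) * P ^ 2 * P =
        M ^ 3 * (1 + ε₀) ^ ((5 : ℝ) * N / 2 + 3 * (-(10 : ℝ) * N)) := by
      rw [Real.rpow_add hq, hq3, hP]
      ring
    rw [h3, mul_comm ((1 + ε₀) ^ (-(N : ℝ)))]
    refine mul_le_mul_of_nonneg_left ?_ (pow_nonneg hM 3)
    exact Real.rpow_le_rpow_of_exponent_le hq1
      (by nlinarith [show (0:ℝ) ≤ N by exact_mod_cast hN])
  calc |botSum ε₀ α X N t|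
      ≤ (1 + ε₀) ^ ((5 : ℝ) * N / 2) * P ^ 2 * P * ∑ i₁, ∑ i₂, ∑ i₃, |α i₁ i₂ i₃ (0, 0, 1)| := hb
    _ ≤ (1 + ε₀) ^ (-(N : ℝ)) * M ^ 3 * ∑ i₁, ∑ i₂, ∑ i₃, |α i₁ i₂ i₃ (0, 0, 1)| :=
        mul_le_mul_of_nonneg_right hpow hC

/-- **The top bond flux of a pseudo-flow vanishes uniformly**: by the a priori regularity (4.5) of a
pseudo-flow on `[0, τ]` (`ε₀ > 0`), for every `δ > 0` there is `N₀` with `|botSum(N)(u)| ≤ δ` for all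
`N ≥ N₀` and all `u ∈ [0, τ]`. [cite: Tao2016AveragedNS, §4 Lemma 4.1 (4.5)] -/
theorem pseudoFlowOn_botSum_tail_small (h : PseudoFlowOn τ ε₀ α κ₁ κ₂ S₀ F₀ B₀ S F) (hε : 0 < ε₀)
    {δ : ℝ} (hδ : 0 < δ) :
    ∃ N₀ : ℤ, ∀ N : ℤ, N₀ ≤ N → ∀ u ∈ Icc 0 τ, |botSum ε₀ α S N u| ≤ δ := by
  have hq : 0 < 1 + ε₀ := by linarith
  have hq1 : 1 ≤ 1 + ε₀ := by linarith
  obtain ⟨M, hM⟩ := h.apriori_S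
  set M' : ℝ := max M 0 with hM'
  have hM'0 : 0 ≤ M' := le_max_right _ _
  have hX : ∀ u ∈ Icc 0 τ, ∀ (i : Fin m) (k : ℤ),
      (1 + (1 + ε₀) ^ ((10 : ℝ) * k)) * |S i k u| ≤ M' :=
    fun u hu i k => (hM u hu i k).trans (le_max_left _ _)
  set C : ℝ := ∑ i₁ : Fin m, ∑ i₂ : Fin m, ∑ i₃ : Fin m, |α i₁ i₂ i₃ (0, 0, 1)| with hCdef
  have hC : 0 ≤ C := Finset.sum_nonneg fun _ _ => Finset.sum_nonneg fun _ _ =>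
    Finset.sum_nonneg fun _ _ => abs_nonneg _
  -- choose n with ((1+ε₀)⁻¹)^n < δ / (M'^3 C + 1)
  have hbinv : (1 + ε₀)⁻¹ < 1 := inv_lt_one_of_one_lt₀ (by linarith)
  have hbinv0 : 0 < (1 + ε₀)⁻¹ := inv_pos.mpr hq
  have hden : 0 < M' ^ 3 * C + 1 := by positivity
  obtain ⟨n, hn⟩ := exists_pow_lt_of_lt_one (div_pos hδ hden) hbinv
  refine ⟨n, fun N hN u hu => ?_⟩
  have hN0 : (0 : ℤ) ≤ N := le_trans (by exact_mod_cast Nat.zero_le n) hN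
  have h1 := abs_botSum_le_of_weight hε.le α S u hM'0 (hX u hu) hN0
  -- (1+ε₀)^{-N} ≤ (1+ε₀)^{-n} = ((1+ε₀)⁻¹)^n
  have h2 : (1 + ε₀) ^ (-(N : ℝ)) ≤ ((1 + ε₀)⁻¹) ^ n := by
    have : (1 + ε₀) ^ (-(N : ℝ)) ≤ (1 + ε₀) ^ (-(n : ℝ)) :=
      Real.rpow_le_rpow_of_exponent_le hq1 (by
        have : (n : ℝ) ≤ (N : ℝ) := by exact_mod_cast hN
        linarith)
    refine this.trans (le_of_eq ?_)
    rw [Real.rpow_neg hq.le, Real.rpow_natCast, inv_pow]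
  calc |botSum ε₀ α S N u| ≤ (1 + ε₀) ^ (-(N : ℝ)) * M' ^ 3 * C := h1
    _ ≤ ((1 + ε₀)⁻¹) ^ n * M' ^ 3 * C := by gcongr
    _ ≤ δ / (M' ^ 3 * C + 1) * (M' ^ 3 * C) := by
        rw [mul_assoc]
        exact mul_le_mul_of_nonneg_right hn.le (by positivity)
    _ ≤ δ := by
        rw [div_mul_eq_mul_div, div_le_iff₀ hden]
        nlinarith

/-! ### The tail energy cap -/

/-- **TAIL ENERGY CAP.** Along every pseudo-flow on `[0, τ]` (`τ > 0`, `ε₀ > 0`, cancelling table), if all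
partial sums of the START energies over the shells `k ≥ K` are at most `E₀`
(`∀ L, ∑_{k<L} ∑_i F₀_{i,K+k} ≤ E₀`), then for every `L` and every `s ∈ [0, τ]`,
`∑_{k<L} ∑_i F_{i,K+k}(s) ≤ E₀ + ∫₀^s botSum(K-1)(u) du`: the energy above the bond `K-1 | K` is fed
only through that bond. (Block inequality on a longer block, whose top flux is uniformly small by
`pseudoFlowOn_botSum_tail_small`.) [cite: Tao2016AveragedNS, §4 Lemma 4.1 (4.5), (4.9) with (4.3)] -/
theorem pseudoFlowOn_tail_energy_le (h : PseudoFlowOn τ ε₀ α κ₁ κ₂ S₀ F₀ B₀ S F) (hτ : 0 < τ)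
    (hε : 0 < ε₀) (hα : IsCancellingCoeff α) (K : ℤ) {E₀ : ℝ}
    (hE₀ : ∀ L : ℕ, ∑ k ∈ Finset.range L, ∑ i, F₀ i (K + k) ≤ E₀)
    (L : ℕ) {s : ℝ} (hs : s ∈ Icc 0 τ) :
    ∑ k ∈ Finset.range L, ∑ i, F i (K + k) s ≤ E₀ + ∫ u in (0 : ℝ)..s, botSum ε₀ α S (K - 1) u := by
  have hS : ∀ i n, ContinuousOn (S i n) (Icc 0 τ) := fun i n => (h.contDiffOn_S i n).continuousOn
  have hsub : uIcc 0 s ⊆ Icc 0 τ := by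
    rw [uIcc_of_le hs.1]
    exact Icc_subset_Icc_right hs.2
  have hbint : ∀ n : ℤ, IntervalIntegrable (fun u => botSum ε₀ α S n u) volume 0 s := fun n =>
    ((continuousOn_botSum ε₀ α hS n).mono hsub).intervalIntegrable
  refine le_of_forall_pos_le_add fun δ' hδ' => ?_
  -- top flux ≤ δ'/τ beyond N₀
  obtain ⟨N₀, hN₀⟩ := pseudoFlowOn_botSum_tail_small h hε (div_pos hδ' hτ)
  -- a longer block whose top shell is beyond N₀
  set L' : ℕ := max L (N₀ - K + 1).toNat with hL'
  have hLL' : L ≤ L' := le_max_left _ _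
  have htop : N₀ ≤ K + L' - 1 := by
    have h1 : (N₀ - K + 1 : ℤ) ≤ ((N₀ - K + 1).toNat : ℤ) := Int.self_le_toNat _
    have h2 : ((N₀ - K + 1).toNat : ℤ) ≤ (L' : ℤ) := by exact_mod_cast le_max_right _ _
    linarith
  have hmono : ∑ k ∈ Finset.range L, ∑ i, F i (K + k) s ≤ ∑ k ∈ Finset.range L', ∑ i, F i (K + k) s :=
    Finset.sum_le_sum_of_subset_of_nonneg (Finset.range_mono hLL') fun k _ _ =>
      Finset.sum_nonneg fun i _ => h.nonneg_F i (K + k) s hs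
  have hblock := pseudoFlowOn_block_energy_le h hτ hα K L' hs
  have htopint : |∫ u in (0 : ℝ)..s, botSum ε₀ α S (K + L' - 1) u| ≤ δ' := by
    have hle : ∀ u ∈ Set.uIoc (0 : ℝ) s, ‖botSum ε₀ α S (K + L' - 1) u‖ ≤ δ' / τ := by
      intro u hu
      rw [uIoc_of_le hs.1] at hu
      exact hN₀ _ htop u ⟨hu.1.le, hu.2.trans hs.2⟩
    have h1 := intervalIntegral.norm_integral_le_of_norm_le_const hle
    rw [Real.norm_eq_abs] at h1
    refine h1.trans ?_
    rw [sub_zero, abs_of_nonneg hs.1, div_mul_eq_mul_div, div_le_iff₀ hτ]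
    exact mul_le_mul_of_nonneg_left hs.2 hδ'.le
  rw [intervalIntegral.integral_sub (hbint _) (hbint _)] at hblock
  have habs := neg_abs_le (∫ u in (0 : ℝ)..s, botSum ε₀ α S (K + L' - 1) u)
  linarith [hE₀ L']

/-- **Per-shell form of the tail energy cap**: under the hypotheses of `pseudoFlowOn_tail_energy_le`,
every single shell `k ≥ K` satisfies `∑_i F_{i,k}(s) ≤ E₀ + ∫₀^s botSum(K-1)`.
[cite: Tao2016AveragedNS, §4 Lemma 4.1 (4.5), (4.9) with (4.3)] -/
theorem pseudoFlowOn_shell_energy_le_tail (h : PseudoFlowOn τ ε₀ α κ₁ κ₂ S₀ F₀ B₀ S F) (hτ : 0 < τ)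
    (hε : 0 < ε₀) (hα : IsCancellingCoeff α) (K : ℤ) {E₀ : ℝ}
    (hE₀ : ∀ L : ℕ, ∑ k ∈ Finset.range L, ∑ i, F₀ i (K + k) ≤ E₀)
    {k : ℤ} (hk : K ≤ k) {s : ℝ} (hs : s ∈ Icc 0 τ) :
    ∑ i, F i k s ≤ E₀ + ∫ u in (0 : ℝ)..s, botSum ε₀ α S (K - 1) u := by
  have hmem : (k - K).toNat ∈ Finset.range ((k - K).toNat + 1) := by simp
  have hk' : K + ((k - K).toNat : ℤ) = k := by
    rw [Int.toNat_of_nonneg (by linarith)]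
    ring
  have h1 : ∑ i, F i k s ≤ ∑ j ∈ Finset.range ((k - K).toNat + 1), ∑ i, F i (K + j) s := by
    have := Finset.single_le_sum (f := fun j : ℕ => ∑ i, F i (K + j) s)
      (fun j _ => Finset.sum_nonneg fun i _ => h.nonneg_F i (K + j) s hs) hmem
    simpa only [hk'] using this
  exact h1.trans (pseudoFlowOn_tail_energy_le h hτ hε hα K hE₀ _ hs)

end GappedFrontRobust

end Summit.NavierStokesRegularity.NavierStokesRegularity.Theorems

end
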